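import Mathlib
import Summits.ValiantsHypothesis.ValiantsHypothesis.Theorems.BarrierLeverPartitionMinorsHitByVPHiddenStatesTiltMoebius

/-!
# Route BarrierLever — item `PartitionMinorsHitByVP` (stmt-ValiantsHypothesis-19717), line `hidden-states`:
# TILTED CUBES V — Möbius inversion on the Boolean lattice of `Fin d` (superset form)

Helper file (`--supports stmt-ValiantsHypothesis-19717`; cell valiant-natproofs, rung V4, 𝒟-side door (c), registered line
`Cruxes/PartitionMinorsHitByVP/Lines/hidden_states.lean` v7; prover seat val-np-p6 gen 12). Definition-free; closes NO item.

`sum_interval_neg_one_pow`: for `T ⊆ X`, `Σ_{T ⊆ A ⊆ X} (−1)^{|X|−|A|} = [T = X]`; **`moebius_inversion`**: every `f : Finset (Fin d) → ℂ` is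
recovered from its superset sums, `f A = Σ_{X ⊇ A} (−1)^{|X|−|A|} Σ_{B ⊇ X} f B`. Used by `…DiagCoreOne` (the core-one class of the
diagonal cell against the big ball).

WHAT THIS IS NOT: bookkeeping; nothing on crux 14610 or VP ≠ VNP.
-/

set_option linter.dupNamespace false

namespace Summit.ValiantsHypothesis.ValiantsHypothesis.Theorems.BarrierLever.HiddenStates

open Finset

noncomputable section

namespace Tilt

variable {d : ℕ}

/-- **Signed interval sum**: for `T ⊆ X`, `Σ_{A : T ⊆ A ⊆ X} (−1)^{|X| − |A|} = [T = X]`. -/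
theorem sum_interval_neg_one_pow (T X : Finset (Fin d)) (hTX : T ⊆ X) :
    ∑ A ∈ Finset.univ.filter (fun A => T ⊆ A ∧ A ⊆ X), (-1 : ℂ) ^ (X.card - A.card) = if T = X then 1 else 0 := by
  classical
  -- substitute `A = X \ E`, `E ⊆ X \ T`
  have hbij : ∑ A ∈ Finset.univ.filter (fun A => T ⊆ A ∧ A ⊆ X), (-1 : ℂ) ^ (X.card - A.card)
      = ∑ E ∈ (X \ T).powerset, (-1 : ℂ) ^ E.card := by
    refine Finset.sum_bij (fun A _ => X \ A) ?_ ?_ ?_ ?_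
    · intro A hA
      obtain ⟨hTA, -⟩ := (Finset.mem_filter.mp hA).2
      exact Finset.mem_powerset.mpr (Finset.sdiff_subset_sdiff subset_rfl hTA)
    · intro A hA A' hA' hAA'
      obtain ⟨-, hAX⟩ := (Finset.mem_filter.mp hA).2
      obtain ⟨-, hA'X⟩ := (Finset.mem_filter.mp hA').2
      have := congrArg (fun E => X \ E) hAA'
      simpa [Finset.sdiff_sdiff_eq_self hAX, Finset.sdiff_sdiff_eq_self hA'X] using this
    · intro E hE
      have hEX : E ⊆ X \ T := Finset.mem_powerset.mp hE
      refine ⟨X \ E, Finset.mem_filter.mpr ⟨Finset.mem_univ _, ?_, Finset.sdiff_subset⟩, ?_⟩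
      · intro x hx
        rw [Finset.mem_sdiff]
        exact ⟨hTX hx, fun hxE => (Finset.mem_sdiff.mp (hEX hxE)).2 hx⟩
      · exact Finset.sdiff_sdiff_eq_self (subset_trans hEX Finset.sdiff_subset)
    · intro A hA
      obtain ⟨-, hAX⟩ := (Finset.mem_filter.mp hA).2
      rw [Finset.card_sdiff_of_subset hAX]
  have hbin : ∑ E ∈ (X \ T).powerset, (-1 : ℂ) ^ E.card = (-1 + 1 : ℂ) ^ (X \ T).card := by
    rw [← Finset.sum_pow_mul_eq_add_pow]
    exact Finset.sum_congr rfl fun E _ => by rw [one_pow, mul_one]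
  rw [hbij, hbin]
  by_cases hT : T = X
  · simp [hT]
  · rw [if_neg hT]
    have hne : (X \ T).card ≠ 0 := by
      intro h0
      apply hT
      rw [Finset.card_eq_zero, Finset.sdiff_eq_empty_iff_subset] at h0
      exact Finset.Subset.antisymm hTX h0
    rw [show (-1 + 1 : ℂ) = 0 by norm_num, zero_pow hne]

/-- **Möbius inversion (superset form).** `f A = Σ_{X ⊇ A} (−1)^{|X|−|A|} · Σ_{B ⊇ X} f B`. -/
theorem moebius_inversion (f : Finset (Fin d) → ℂ) (A : Finset (Fin d)) :
    f A = ∑ X ∈ Finset.univ.filter (fun X => A ⊆ X),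
      (-1 : ℂ) ^ (X.card - A.card) * ∑ B ∈ Finset.univ.filter (fun B => X ⊆ B), f B := by
  classical
  -- the right-hand side as a function of `A`
  set g : Finset (Fin d) → ℂ := fun A => ∑ X ∈ Finset.univ.filter (fun X => A ⊆ X),
      (-1 : ℂ) ^ (X.card - A.card) * ∑ B ∈ Finset.univ.filter (fun B => X ⊆ B), f B with hg
  suffices h : ∀ A, (fun A => f A - g A) A = 0 by have := h A; simp only at this; exact (sub_eq_zero.mp this)
  refine eq_zero_of_sum_supersets (fun A => f A - g A) fun T => ?_
  rw [Finset.sum_sub_distrib, sub_eq_zero]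
  -- Σ_{A ⊇ T} g A = Σ_X (Σ_{B ⊇ X} f B) · Σ_{T ⊆ A ⊆ X} (−1)^{|X|−|A|} = Σ_{B ⊇ T} f B
  have hexp : ∑ A ∈ Finset.univ.filter (fun A => T ⊆ A), g A
      = ∑ X, (∑ B ∈ Finset.univ.filter (fun B => X ⊆ B), f B) *
          ∑ A ∈ Finset.univ.filter (fun A => T ⊆ A ∧ A ⊆ X), (-1 : ℂ) ^ (X.card - A.card) := by
    simp only [hg]
    rw [Finset.sum_filter]
    have h1 : ∀ A : Finset (Fin d), (if T ⊆ A then ∑ X ∈ Finset.univ.filter (fun X => A ⊆ X),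
        (-1 : ℂ) ^ (X.card - A.card) * ∑ B ∈ Finset.univ.filter (fun B => X ⊆ B), f B else 0)
        = ∑ X, (if T ⊆ A ∧ A ⊆ X then (-1 : ℂ) ^ (X.card - A.card) * ∑ B ∈ Finset.univ.filter (fun B => X ⊆ B), f B else 0) := by
      intro A
      by_cases hTA : T ⊆ A
      · rw [if_pos hTA, Finset.sum_filter]
        refine Finset.sum_congr rfl fun X _ => ?_
        by_cases hAX : A ⊆ X <;> simp [hTA, hAX]
      · rw [if_neg hTA]
        symm
        exact Finset.sum_eq_zero fun X _ => by rw [if_neg (fun h => hTA h.1)]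
    rw [Finset.sum_congr rfl fun A _ => h1 A, Finset.sum_comm]
    refine Finset.sum_congr rfl fun X _ => ?_
    rw [Finset.mul_sum, Finset.sum_filter (fun A => T ⊆ A ∧ A ⊆ X)]
    refine Finset.sum_congr rfl fun A _ => ?_
    by_cases h : T ⊆ A ∧ A ⊆ X <;> simp [h, mul_comm]
  rw [hexp]
  -- only `X ⊇ T` contribute, and there the interval sum is `[T = X]`
  have hR : ∑ X ∈ Finset.univ.filter (fun X => T ⊆ X), (∑ B ∈ Finset.univ.filter (fun B => X ⊆ B), f B) *
      ∑ A ∈ Finset.univ.filter (fun A => T ⊆ A ∧ A ⊆ X), (-1 : ℂ) ^ (X.card - A.card)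
      = ∑ B ∈ Finset.univ.filter (fun B => T ⊆ B), f B := by
    rw [Finset.sum_eq_single_of_mem T (Finset.mem_filter.mpr ⟨Finset.mem_univ _, subset_rfl⟩)]
    · rw [sum_interval_neg_one_pow T T subset_rfl, if_pos rfl, mul_one]
    · intro X hX hXT
      rw [sum_interval_neg_one_pow T X (Finset.mem_filter.mp hX).2, if_neg (Ne.symm hXT), mul_zero]
  rw [← hR]
  apply Finset.sum_subset (Finset.subset_univ (Finset.univ.filter fun X => T ⊆ X))
  · intro X _ hX
    have hTX : ¬ T ⊆ X := fun h => hX (Finset.mem_filter.mpr ⟨Finset.mem_univ _, h⟩)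
    have : Finset.univ.filter (fun A : Finset (Fin d) => T ⊆ A ∧ A ⊆ X) = ∅ := by
      ext A; simp only [Finset.mem_filter, Finset.mem_univ, true_and, Finset.notMem_empty, iff_false, not_and]
      exact fun hTA hAX => hTX (subset_trans hTA hAX)
    rw [this, Finset.sum_empty, mul_zero]

end Tilt

end

end Summit.ValiantsHypothesis.ValiantsHypothesis.Theorems.BarrierLever.HiddenStates
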